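import Literature.Barriers.ValiantsHypothesis.BDGIL24NaturalProofsMainTheoremProofs
import HarnessLib

/-!
# van den Berg–Dutta–Gesmundo–Ikenmeyer–Lysikov 2024, §2.2 "Lower bounds via isotypic
# metapolynomials" — PROVED (isotypic and highest-weight forms)

Theorem-only companion of `BDGIL24NaturalProofsMainTheoremProofs.lean` (val-lit row
vdBDGIL24-A). The paper's announced application of Thm. 1.1 (§2.2, p.7): "suppose `Δ` is a
(homogeneous) metapolynomial vanishing on `X_r` and such that `Δ(f_hard) ≠ 0` … if `c(·)` is an
invariant complexity measure, then `X_r` is invariant under the action of `GL_k` … there exists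
at least one `λ` such that `Δ^{(λ)}(f_hard) ≠ 0` … if the lower bound `c(f_hard) > r` can be proved
via a metapolynomial `Δ` satisfying `cc(Δ) ≤ s`, then the same lower bound can be proved via an
isotypic metapolynomial with circuit complexity controlled by the parameter `s`."

* `exists_isotypic_lowerBound` — that sentence, with the orbit-span bound of Thm. 1.1 (2):
  an ISOTYPIC `Δ' ∈ span (GL_k · Δ)`, homogeneous of the same degree, vanishing on `X_{d,r}`,
  `Δ'(f) ≠ 0`, `cc(Δ') ≤ (δd+1)^{k²-1} (s+2)`.
* `exists_hwv_lowerBound` — the highest-weight form (§2.3): a HIGHEST-WEIGHT VECTOR `v` in the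
  orbit span with the same three properties and `v(g · f) ≠ 0` for some `g ∈ GL_k` (so `v`
  proves `c(g · f) > r`, i.e. `c(f) > r` by invariance).

Mechanism (disclosed deviation from the print, which projects `Δ` onto an isotypic component):
`Δ` lies in the span of the `GL_k`-translates of the highest-weight vectors of its
(finite-dimensional, `GL_k`-stable) orbit span (`le_span_translates_highestWeight`,
`BDGIL24IsotypicProjectionProofs.lean`), and evaluation at `f` is linear, so some translate
`g · v` of a highest-weight vector `v` of the orbit span has `(g · v)(f) = v(g⁻¹ · f) ≠ 0`; every
element of the orbit span vanishes on `X_{d,r}` (`eval_formCoeff_eq_zero_of_mem_span_orbit`) and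
has `cc ≤ (δd+1)^{k²-1}(s+2)` (`affComplexity_le_of_mem_span_orbit'`).

No definitions, no new facts (net debt 0). Honest framing: nothing here bears on `VP ≠ VNP`,
which is NOT proved; these are transfer statements about lower-bound witnesses.

## References
* [BergEtAl2024] arXiv:2411.03444, §2.2 (p.7, PDF p.8: "Lower bounds via isotypic
  metapolynomials"), §2.3 (p.7–8), Thm. 1.1; held text `paper:arxiv-2411.03444` p0008.

## Mathlib and tree
Tree: `BDGIL24IsotypicProjectionProofs` (`le_span_translates_highestWeight`,
`exists_finset_forall_coordRep_mem_span`, `span_orbit_le_comap`, `self_mem_span_orbit`),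
`BDGIL24HighestWeightProjectionProofs` (`isHomogeneous_of_mem_span_orbit`),
`BDGIL24NaturalProofsMainTheoremProofs` (`eval_formCoeff_eq_zero_of_mem_span_orbit`,
`affComplexity_le_of_mem_span_orbit'`), `OrbitCoordinateRing` (`aeval_formCoeff_coordSubst`),
`CoordRepRational` (`isRationalRep_coordRep`), `BDGIL24IsotypicNaturalProofs` (`IsIsotypic`,
`slice`, `IsInvariantMeasure`).
-/

noncomputable section

open MvPolynomial
open Literature.Computability.AlgebraicComplexity Literature.NumberTheory.DiophantineGeometry

namespace Literature.Barriers.ValiantsHypothesis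

namespace BergEtAl2024

section IsotypicLowerBounds

/-- Evaluation at a coefficient vector kills a span as soon as it kills its generators.
("there exists at least one `λ` such that `Δ^{(λ)}(f_hard) ≠ 0`", §2.2.)
[cite: BergEtAl2024, §2.2, p.7 (PDF p.8)] -/
theorem eval_formCoeff_eq_zero_of_mem_span {k d : ℕ} {S : Set (MvPolynomial (DegIdx (Fin k) d) ℂ)}
    {f : MvPolynomial (Fin k) ℂ} (hS : ∀ x ∈ S, eval (formCoeff d f) x = 0)
    {w : MvPolynomial (DegIdx (Fin k) d) ℂ} (hw : w ∈ Submodule.span ℂ S) :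
    eval (formCoeff d f) w = 0 := by
  induction hw using Submodule.span_induction with
  | mem z hz => exact hS z hz
  | zero => exact map_zero _
  | add x y _ _ hx hy => rw [map_add, hx, hy, add_zero]
  | smul a x _ hx => rw [smul_eq_C_mul, map_mul, hx, mul_zero]

/-- **Lower bounds via highest-weight metapolynomials** (§2.2–§2.3): let `c` be an invariant
measure, `Δ` a homogeneous degree-`δ` metapolynomial of format `(δ, d, k)` with `cc(Δ) ≤ s`
vanishing on `X_{d,r}` and with `Δ(f) ≠ 0` (a proof of the lower bound `c(f) > r`). Then there
are a HIGHEST-WEIGHT VECTOR `v` in the orbit span `span (GL_k · Δ)` — so `v` is homogeneous of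
degree `δ`, vanishes on `X_{d,r}`, and `cc(v) ≤ (δd+1)^{k²-1} (s+2)` — and `g ∈ GL_k` with
`v(g · f) ≠ 0`: the same lower bound (`c(g · f) = c(f) > r`) is proved by a highest-weight
vector of controlled circuit size. (Mechanism: `Δ` lies in the span of the `GL_k`-translates of
the highest-weight vectors of its orbit span, `le_span_translates_highestWeight`; evaluation at
`f` is linear.)
[cite: BergEtAl2024, §2.2 ("Lower bounds via isotypic metapolynomials") and §2.3, p.7–8] -/
theorem exists_hwv_lowerBound {c : (k d : ℕ) → MvPolynomial (Fin k) ℂ → ℕ}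
    (hc : IsInvariantMeasure c) {k d r δ s : ℕ} {Δ : MvPolynomial (DegIdx (Fin k) d) ℂ}
    (hΔ : Δ.IsHomogeneous δ) (hs : affComplexity Δ ≤ s)
    (hvan : ∀ g ∈ slice c k d r, eval (formCoeff d g) Δ = 0) {f : MvPolynomial (Fin k) ℂ}
    (hf : eval (formCoeff d f) Δ ≠ 0) :
    ∃ (v : MvPolynomial (DegIdx (Fin k) d) ℂ) (χ : Weight (Fin k)) (g : GL (Fin k) ℂ),
      v ∈ highestWeightSpace (coordRep (Fin k) ℂ d) χ ∧
      v ∈ Submodule.span ℂ (Set.range fun h : GL (Fin k) ℂ => coordRep (Fin k) ℂ d h Δ) ∧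
      v.IsHomogeneous δ ∧ (∀ g' ∈ slice c k d r, eval (formCoeff d g') v = 0) ∧
      eval (formCoeff d (linSubstRep (Fin k) ℂ g f)) v ≠ 0 ∧
      affComplexity v ≤ (δ * d + 1) ^ (k * k - 1) * (s + 2) := by
  classical
  set ρ := coordRep (Fin k) ℂ d with hρ
  set M := Submodule.span ℂ (Set.range fun h : GL (Fin k) ℂ => ρ h Δ) with hM
  have hMstab : ∀ g, M ≤ M.comap (ρ g) := span_orbit_le_comap Δ
  obtain ⟨T, -, hTmem⟩ := exists_finset_forall_coordRep_mem_span Δ hΔ.totalDegree_le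
  have hMT : M ≤ Submodule.span ℂ (T : Set (MvPolynomial (DegIdx (Fin k) d) ℂ)) :=
    Submodule.span_le.mpr (by rintro _ ⟨g, rfl⟩; exact hTmem g)
  haveI : FiniteDimensional ℂ M := Submodule.finiteDimensional_of_le hMT
  have hΔS := le_span_translates_highestWeight (isRationalRep_coordRep d) M hMstab
    (self_mem_span_orbit Δ)
  -- some translate `ρ g v` of a highest-weight vector `v ∈ M` does not vanish at `f`
  have hex : ∃ (g : GL (Fin k) ℂ) (v : MvPolynomial (DegIdx (Fin k) d) ℂ) (χ : Weight (Fin k)),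
      v ∈ M ∧ v ∈ highestWeightSpace ρ χ ∧ eval (formCoeff d f) (ρ g v) ≠ 0 := by
    by_contra hcon
    push Not at hcon
    refine hf (eval_formCoeff_eq_zero_of_mem_span (fun x hx => ?_) hΔS)
    obtain ⟨g, v, χ, hvM, hvχ, rfl⟩ := hx
    exact hcon g v χ hvM hvχ
  obtain ⟨g, v, χ, hvM, hvχ, hne⟩ := hex
  refine ⟨v, χ, g⁻¹, hvχ, hvM, isHomogeneous_of_mem_span_orbit hΔ hvM,
    fun g' hg' => eval_formCoeff_eq_zero_of_mem_span_orbit hc hvan hvM hg', ?_,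
    affComplexity_le_of_mem_span_orbit' hΔ hs hvM⟩
  have h : eval (formCoeff d f) (ρ g v) = eval (formCoeff d (linSubstRep (Fin k) ℂ g⁻¹ f)) v :=
    aeval_formCoeff_coordSubst d g f v
  rwa [h] at hne

/-- **Lower bounds via isotypic metapolynomials** (§2.2, the announced application of Thm. 1.1):
"if the lower bound `c(f_hard) > r` can be proved via a metapolynomial `Δ` satisfying
`cc(Δ) ≤ s`, then the same lower bound can be proved via an isotypic metapolynomial with circuit
complexity controlled by the parameter `s`" — for an invariant measure `c` and a homogeneous
degree-`δ` format-`(δ, d, k)` metapolynomial `Δ` vanishing on `X_{d,r}` with `Δ(f) ≠ 0`, there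
is an ISOTYPIC `Δ'` in `span (GL_k · Δ)`, homogeneous of degree `δ`, vanishing on `X_{d,r}`,
with `Δ'(f) ≠ 0` and `cc(Δ') ≤ (δd+1)^{k²-1} (cc(Δ)+2)` (the orbit-span form of Thm. 1.1 (2),
sharper than the printed `O(s k^{2k²} (δd)^{2k³})`). Here `Δ'` is a `GL_k`-translate of the
highest-weight vector of `exists_hwv_lowerBound` (the print projects onto an isotypic component;
either realises the quoted sentence).
[cite: BergEtAl2024, §2.2 ("Lower bounds via isotypic metapolynomials"), p.7 (PDF p.8)] -/
theorem exists_isotypic_lowerBound {c : (k d : ℕ) → MvPolynomial (Fin k) ℂ → ℕ}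
    (hc : IsInvariantMeasure c) {k d r δ s : ℕ} {Δ : MvPolynomial (DegIdx (Fin k) d) ℂ}
    (hΔ : Δ.IsHomogeneous δ) (hs : affComplexity Δ ≤ s)
    (hvan : ∀ g ∈ slice c k d r, eval (formCoeff d g) Δ = 0) {f : MvPolynomial (Fin k) ℂ}
    (hf : eval (formCoeff d f) Δ ≠ 0) :
    ∃ Δ' : MvPolynomial (DegIdx (Fin k) d) ℂ, IsIsotypic Δ' ∧
      Δ' ∈ Submodule.span ℂ (Set.range fun h : GL (Fin k) ℂ => coordRep (Fin k) ℂ d h Δ) ∧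
      Δ'.IsHomogeneous δ ∧ (∀ g' ∈ slice c k d r, eval (formCoeff d g') Δ' = 0) ∧
      eval (formCoeff d f) Δ' ≠ 0 ∧ affComplexity Δ' ≤ (δ * d + 1) ^ (k * k - 1) * (s + 2) := by
  obtain ⟨v, χ, g, hvχ, hvM, -, -, hne, -⟩ := exists_hwv_lowerBound hc hΔ hs hvan hf
  have hgvM : coordRep (Fin k) ℂ d g⁻¹ v ∈
      Submodule.span ℂ (Set.range fun h : GL (Fin k) ℂ => coordRep (Fin k) ℂ d h Δ) :=
    span_orbit_le_comap Δ g⁻¹ hvM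
  refine ⟨coordRep (Fin k) ℂ d g⁻¹ v, ⟨χ, Submodule.subset_span ⟨g⁻¹, v, hvχ, rfl⟩⟩, hgvM,
    isHomogeneous_of_mem_span_orbit hΔ hgvM,
    fun g' hg' => eval_formCoeff_eq_zero_of_mem_span_orbit hc hvan hgvM hg', ?_,
    affComplexity_le_of_mem_span_orbit' hΔ hs hgvM⟩
  have h : eval (formCoeff d f) (coordRep (Fin k) ℂ d g⁻¹ v) =
      eval (formCoeff d (linSubstRep (Fin k) ℂ g⁻¹⁻¹ f)) v :=
    aeval_formCoeff_coordSubst d g⁻¹ f v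
  rw [h, inv_inv]
  exact hne

end IsotypicLowerBounds

end BergEtAl2024

end Literature.Barriers.ValiantsHypothesis

end
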